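import Mathlib.GroupTheory.SemidirectProduct
import Mathlib.Data.ZMod.QuotientGroup
import Mathlib.Algebra.BigOperators.Intervals
import Mathlib.Tactic.Ring
import Mathlib.Tactic.FinCases
import Literature.GroupTheory.CombinatorialGroupTheory.PuncturedSurfaceGroupElevationQuotients
import HarnessLib

/-!
# The tripod `Γ_{0,3}`: a finite quotient with uniform cusp order and a central avoiding subgroup

Completes `PuncturedSurfaceGroupElevationQuotients.lean` ([SemiAnbd] Ex. 2.10 "totally elevated",
input for row G31 (2); [cite: MochizukiSemiAnbd2006, Ex. 2.10 p.31]) with the type `(0, 3)`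
(`Γ_{0,3} = ⟨c₁, c₂, c₃ ∣ c₁c₂c₃⟩`, free on `c₁, c₂`), where no abelian target works for `p = 2`:
for a prime `p` and `k : ℕ`, with `n = p^(k+1)`, `m = p^k`, the metabelian group
`Q = (ℤ/n × ℤ/m) ⋊ ℤ/n`, `a · (b, c) = (b, c + ab mod m)`, and `c₁ ↦ u = (0;1)`, `c₂ ↦ w = ((1,0);0)`,
`c₃ ↦ (uw)⁻¹` — all three of order exactly `n` ((`uw)^n = 1` because `m ∣ n` and
`m ∣ n(n−1)/2`) — with `N = ⟨z⟩`, `z = [u,w] = ((0,1);0)` central of order `m`, which meets every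
conjugate of `⟨u⟩, ⟨w⟩, ⟨uw⟩` trivially (seen through `Q → ℤ/n × ℤ/n`).  Then the all-types statement
`exists_hom_cuspOrder_avoiding`.  Theorems only; no statement here takes a side on any disputed claim.
-/

namespace Literature.GroupTheory.CombinatorialGroupTheory.PuncturedSurfaceGroup

open Multiplicative
open scoped Pointwise

variable {g r : ℕ}

/-- The image of the relator under `FreeGroup.lift` (private copy). [cite: MochizukiSemiAnbd2006, Ex. 2.10 p.31] -/
private theorem lift_relator'' {M : Type*} [Group M] (f : puncturedSurfaceGen g r → M) :
    FreeGroup.lift f (relator g r) =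
      ((List.finRange g).map fun i =>
          f (Sum.inl (i, false)) * f (Sum.inl (i, true)) * (f (Sum.inl (i, false)))⁻¹ *
            (f (Sum.inl (i, true)))⁻¹).prod *
        ((List.finRange r).map fun j => f (Sum.inr j)).prod := by
  simp only [relator, map_mul, map_list_prod, List.map_map, Function.comp_def, map_inv, genA, genB,
    genC, FreeGroup.lift_apply_of]

/-- `p ^ k` divides `0 + 1 + ⋯ + (p^(k+1) − 1) = p^(k+1)(p^(k+1) − 1)/2`. [folklore] -/
private theorem pow_dvd_sum_range {p : ℕ} (hp : p.Prime) (k : ℕ) :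
    p ^ k ∣ ∑ i ∈ Finset.range (p ^ (k + 1)), i := by
  have h2 := Finset.sum_range_id_mul_two (p ^ (k + 1))
  set S := ∑ i ∈ Finset.range (p ^ (k + 1)), i with hS
  rcases hp.eq_two_or_odd' with rfl | hodd
  · -- `2 S = 2^(k+1) (2^(k+1) - 1)` so `S = 2^k (2^(k+1) - 1)`
    have : S = 2 ^ k * (2 ^ (k + 1) - 1) := by
      have h3 : S * 2 = 2 ^ k * (2 ^ (k + 1) - 1) * 2 := by rw [h2]; ring
      exact Nat.eq_of_mul_eq_mul_right two_pos h3
    rw [this]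
    exact dvd_mul_right _ _
  · -- `p` odd: `p^(k+1) ∣ 2 S`, hence `p^(k+1) ∣ S`
    have hdvd : p ^ (k + 1) ∣ S * 2 := by rw [h2]; exact dvd_mul_right _ _
    have hcop : Nat.Coprime (p ^ (k + 1)) 2 := (Nat.Coprime.pow_left _ hodd.coprime_two_right)
    exact (pow_dvd_pow p (Nat.le_succ k)).trans (hcop.dvd_of_dvd_mul_right hdvd)

/-- **The tripod.** For `Γ_{0,3}`, a prime `p` and `k : ℕ`: a homomorphism `f : Γ_{0,3} → Q` to a
finite group of `p`-power order with `f(c₁), f(c₂), f(c₃)` of order exactly `p^(k+1)` and a subgroup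
`N ⊆ f(Γ)` of order `≥ p^k` meeting every conjugate of every `⟨f(c_j)⟩` trivially — realised in
`(ℤ/p^(k+1) × ℤ/p^k) ⋊ ℤ/p^(k+1)`, `N` the centre-part `⟨((0,1);0)⟩`.
[cite: MochizukiSemiAnbd2006, Ex. 2.10 p.31] -/
theorem exists_hom_cuspOrder_avoiding_tripod {p : ℕ} (hp : p.Prime) (k : ℕ) :
    ∃ (Q : Type) (_ : Group Q) (_ : Finite Q) (f : PuncturedSurfaceGroup 0 3 →* Q)
      (N : Subgroup Q), (∃ a, Nat.card Q ∣ p ^ a) ∧ (∀ j, orderOf (f (c j)) = p ^ (k + 1)) ∧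
      N ≤ f.range ∧ p ^ k ≤ Nat.card N ∧
      ∀ (j : Fin 3) (q : Q), N ⊓ ConjAct.toConjAct q • Subgroup.zpowers (f (c j)) = ⊥ := by
  set n := p ^ (k + 1) with hn
  set m := p ^ k with hm
  haveI : NeZero n := ⟨pow_ne_zero _ hp.ne_zero⟩
  haveI : NeZero m := ⟨pow_ne_zero _ hp.ne_zero⟩
  have hmn : m ∣ n := by rw [hn, hm]; exact pow_dvd_pow p (Nat.le_succ k)
  let π : ZMod n →+* ZMod m := ZMod.castHom hmn (ZMod m)
  -- the action of `ℤ/n` on `ℤ/n × ℤ/m`: `a · (b, c) = (b, c + π(ab))`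
  let σ : Multiplicative (ZMod n) →* MulAut (Multiplicative (ZMod n × ZMod m)) :=
    { toFun := fun t =>
        { toFun := fun q => ofAdd (q.toAdd.1, q.toAdd.2 + π (t.toAdd * q.toAdd.1))
          invFun := fun q => ofAdd (q.toAdd.1, q.toAdd.2 - π (t.toAdd * q.toAdd.1))
          left_inv := fun q => by simp
          right_inv := fun q => by simp
          map_mul' := fun q q' => by
            rw [← ofAdd_add, Prod.mk_add_mk, toAdd_mul, Prod.fst_add, Prod.snd_add, mul_add, map_add]
            exact congrArg ofAdd (Prod.ext rfl (by dsimp only; ring)) }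
      map_one' := by
        ext q
        · simp
        · simp
      map_mul' := fun t t' => by
        ext q
        · simp
        · simp only [toAdd_mul, MulAut.mul_apply, MulEquiv.coe_mk, Equiv.coe_fn_mk, toAdd_ofAdd,
            add_mul, map_add]
          ring }
  have hσ : ∀ (t : Multiplicative (ZMod n)) (b : ZMod n) (e : ZMod m),
      σ t (ofAdd (b, e)) = ofAdd (b, e + π (t.toAdd * b)) := fun _ _ _ => rfl
  let u : Multiplicative (ZMod n × ZMod m) ⋊[σ] Multiplicative (ZMod n) :=
    SemidirectProduct.inr (ofAdd 1)
  let w : Multiplicative (ZMod n × ZMod m) ⋊[σ] Multiplicative (ZMod n) :=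
    SemidirectProduct.inl (ofAdd (1, 0))
  let z : Multiplicative (ZMod n × ZMod m) ⋊[σ] Multiplicative (ZMod n) :=
    SemidirectProduct.inl (ofAdd (0, 1))
  -- the quotient `Q → ℤ/n × ℤ/n`, `((b,c);a) ↦ (a, b)`
  let ρ : (Multiplicative (ZMod n × ZMod m) ⋊[σ] Multiplicative (ZMod n)) →*
      Multiplicative (ZMod n × ZMod n) :=
    SemidirectProduct.lift
      ((AddMonoidHom.toMultiplicative ((AddMonoidHom.inr (ZMod n) (ZMod n)).comp
        (AddMonoidHom.fst (ZMod n) (ZMod m)))))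
      ((AddMonoidHom.toMultiplicative (AddMonoidHom.inl (ZMod n) (ZMod n))))
      (fun t => by
        ext q
        · simp
        · simp [hσ])
  have hρu : ρ u = ofAdd (1, 0) := by
    simp [ρ, u, SemidirectProduct.lift_inr]
  have hρw : ρ w = ofAdd (0, 1) := by
    simp [ρ, w, SemidirectProduct.lift_inl]
  have hρz : ρ z = 1 := by
    simp [ρ, z, SemidirectProduct.lift_inl]
  -- orders of `u`, `w`, `z`
  have horu : orderOf u = n := by
    rw [orderOf_injective SemidirectProduct.inr SemidirectProduct.inr_injective,
      orderOf_ofAdd_eq_addOrderOf, ZMod.addOrderOf_one]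
  have horw : orderOf w = n := by
    rw [orderOf_injective SemidirectProduct.inl SemidirectProduct.inl_injective,
      orderOf_ofAdd_eq_addOrderOf, Prod.addOrderOf, ZMod.addOrderOf_one, addOrderOf_zero,
      Nat.lcm_one_right]
  have horz : orderOf z = m := by
    rw [orderOf_injective SemidirectProduct.inl SemidirectProduct.inl_injective,
      orderOf_ofAdd_eq_addOrderOf, Prod.addOrderOf, ZMod.addOrderOf_one, addOrderOf_zero,
      Nat.lcm_one_left]
  -- the commutator `[u, w] = z`
  have huwu : u * w * u⁻¹ = SemidirectProduct.inl (ofAdd ((1 : ZMod n), (1 : ZMod m))) := by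
    rw [← map_inv, ← SemidirectProduct.inl_aut, hσ]
    simp
  have hz : u * w * u⁻¹ * w⁻¹ = z := by
    rw [huwu, ← map_inv, ← map_mul, ← ofAdd_neg, ← ofAdd_add, Prod.neg_mk, Prod.mk_add_mk]
    simp [z]
  -- `(uw)^n = 1`: the power formula
  have hcomm : ∀ (t : Multiplicative (ZMod n)) (v : Multiplicative (ZMod n × ZMod m)),
      (SemidirectProduct.inr t : Multiplicative (ZMod n × ZMod m) ⋊[σ] Multiplicative (ZMod n)) *
        SemidirectProduct.inl v = SemidirectProduct.inl (σ t v) * SemidirectProduct.inr t := by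
    intro t v
    ext <;> simp
  have huw : u * w = SemidirectProduct.inl (ofAdd ((1 : ZMod n), (1 : ZMod m))) * u := by
    rw [← huwu, inv_mul_cancel_right]
  have hpow : ∀ j : ℕ, (u * w) ^ j =
      SemidirectProduct.inl (ofAdd ((j : ZMod n), ((j + ∑ i ∈ Finset.range j, i : ℕ) : ZMod m))) *
        SemidirectProduct.inr (ofAdd (j : ZMod n)) := by
    intro j
    induction j with
    | zero =>
      rw [pow_zero]
      simp only [Nat.cast_zero, Finset.range_zero, Finset.sum_empty, add_zero]
      rw [show ((0 : ZMod n), (0 : ZMod m)) = 0 from rfl, ofAdd_zero, map_one, ofAdd_zero, map_one,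
        mul_one]
    | succ j ih =>
      rw [pow_succ, ih, huw, mul_assoc,
        ← mul_assoc (SemidirectProduct.inr (ofAdd (j : ZMod n))) (SemidirectProduct.inl _) u, hcomm,
        mul_assoc, ← mul_assoc (SemidirectProduct.inl _) (SemidirectProduct.inl _), ← map_mul,
        ← map_mul, hσ]
      congr 2
      · rw [← ofAdd_add, Prod.mk_add_mk, toAdd_ofAdd, mul_one, map_natCast, Finset.sum_range_succ]
        push_cast
        congr 1
        ext
        · rfl
        · dsimp only; ring
      · rw [← ofAdd_add, Nat.cast_succ]
  have huwn : (u * w) ^ n = 1 := by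
    rw [hpow n, ZMod.natCast_self, (ZMod.natCast_eq_zero_iff _ m).2
      (dvd_add hmn (pow_dvd_sum_range hp k))]
    rw [show ((0 : ZMod n), (0 : ZMod m)) = 0 from rfl, ofAdd_zero, ofAdd_zero, map_one, map_one,
      mul_one]
  have hρuw : ρ (u * w) = ofAdd (1, 1) := by
    rw [map_mul, hρu, hρw, ← ofAdd_add, Prod.mk_add_mk, add_zero, zero_add]
  have horuw : orderOf (u * w) = n := by
    refine Nat.dvd_antisymm (orderOf_dvd_of_pow_eq_one huwn) ?_
    have h1 : orderOf (ρ (u * w)) = n := by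
      rw [hρuw, orderOf_ofAdd_eq_addOrderOf, Prod.addOrderOf, ZMod.addOrderOf_one, Nat.lcm_self]
    have h2 := orderOf_map_dvd ρ (u * w)
    rwa [h1] at h2
  -- the homomorphism `Γ_{0,3} → Q`
  let F : puncturedSurfaceGen 0 3 → Multiplicative (ZMod n × ZMod m) ⋊[σ] Multiplicative (ZMod n) :=
    Sum.elim (fun ib => ib.1.elim0) (![u, w, (u * w)⁻¹])
  have hrel : ∀ x ∈ ({relator 0 3} : Set (FreeGroup (puncturedSurfaceGen 0 3))),
      FreeGroup.lift F x = 1 := by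
    intro x hx
    rw [Set.mem_singleton_iff] at hx
    subst hx
    rw [lift_relator'']
    have h2 : ((List.finRange 3).map fun j => F (Sum.inr j)).prod = 1 := by
      rw [show List.finRange 3 = [0, 1, 2] from rfl]
      simp only [List.map_cons, List.map_nil, List.prod_cons, List.prod_nil, mul_one]
      change u * (w * (u * w)⁻¹) = 1
      rw [← mul_assoc, mul_inv_cancel]
    rw [h2, mul_one]
    rfl
  let f : PuncturedSurfaceGroup 0 3 →* _ := PresentedGroup.toGroup hrel
  have hf0 : f (c 0) = u := by rw [c, PresentedGroup.toGroup.of]; rfl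
  have hf1 : f (c 1) = w := by rw [c, PresentedGroup.toGroup.of]; rfl
  have hf2 : f (c 2) = (u * w)⁻¹ := by rw [c, PresentedGroup.toGroup.of]; rfl
  have hford : ∀ j, orderOf (f (c j)) = n := by
    intro j
    fin_cases j
    · exact hf0 ▸ horu
    · exact hf1 ▸ horw
    · rw [show (⟨2, by norm_num⟩ : Fin 3) = 2 from rfl, hf2, orderOf_inv, horuw]
  have hρord : ∀ j, orderOf (ρ (f (c j))) = orderOf (f (c j)) := by
    intro j
    rw [hford j]
    fin_cases j
    · rw [show (⟨0, by norm_num⟩ : Fin 3) = 0 from rfl, hf0, hρu, orderOf_ofAdd_eq_addOrderOf,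
        Prod.addOrderOf, ZMod.addOrderOf_one, addOrderOf_zero, Nat.lcm_one_right]
    · rw [show (⟨1, by norm_num⟩ : Fin 3) = 1 from rfl, hf1, hρw, orderOf_ofAdd_eq_addOrderOf,
        Prod.addOrderOf, ZMod.addOrderOf_one, addOrderOf_zero, Nat.lcm_one_left]
    · rw [show (⟨2, by norm_num⟩ : Fin 3) = 2 from rfl, hf2, map_inv, orderOf_inv, hρuw,
        orderOf_ofAdd_eq_addOrderOf, Prod.addOrderOf, ZMod.addOrderOf_one, Nat.lcm_self]
  haveI : Finite (Multiplicative (ZMod n × ZMod m) ⋊[σ] Multiplicative (ZMod n)) :=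
    Finite.of_equiv _ SemidirectProduct.equivProd.symm
  refine ⟨_, inferInstance, inferInstance, f, Subgroup.zpowers z, ⟨(k + 1) + k + (k + 1), ?_⟩,
    hford, ?_, ?_, fun j q => ?_⟩
  · refine dvd_of_eq ?_
    rw [Nat.card_congr SemidirectProduct.equivProd, Nat.card_prod, Nat.card_congr Multiplicative.toAdd,
      Nat.card_prod, Nat.card_zmod, Nat.card_zmod, Nat.card_congr Multiplicative.toAdd, Nat.card_zmod,
      hn, hm, ← pow_add, ← pow_add]
  · rw [Subgroup.zpowers_le, ← hz, ← hf0, ← hf1, ← map_inv, ← map_inv, ← map_mul, ← map_mul,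
      ← map_mul]
    exact ⟨_, rfl⟩
  · rw [Nat.card_zpowers, horz]
  · refine avoiding_inf_eq_bot ρ _ ?_ _ (hρord j) q
    rw [Subgroup.zpowers_le, MonoidHom.mem_ker, hρz]

/-- **All hyperbolic types.** For `(g, r)` hyperbolic, a prime `p` and `k : ℕ`: a homomorphism
`f : Γ_{g,r} → Q` to a finite group of `p`-power order with every cusp generator of order exactly
`p^(k+1)` and a subgroup `N ⊆ f(Γ)` of order `≥ p^k` meeting every conjugate of every `⟨f(c_j)⟩`
trivially. [cite: MochizukiSemiAnbd2006, Ex. 2.10 p.31] -/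
theorem exists_hom_cuspOrder_avoiding (h : IsHyperbolicType g r) {p : ℕ} (hp : p.Prime) (k : ℕ) :
    ∃ (Q : Type) (_ : Group Q) (_ : Finite Q) (f : PuncturedSurfaceGroup g r →* Q)
      (N : Subgroup Q), (∃ a, Nat.card Q ∣ p ^ a) ∧ (∀ j, orderOf (f (c j)) = p ^ (k + 1)) ∧
      N ≤ f.range ∧ p ^ k ≤ Nat.card N ∧
      ∀ (j : Fin r) (q : Q), N ⊓ ConjAct.toConjAct q • Subgroup.zpowers (f (c j)) = ⊥ := by
  rcases Nat.eq_zero_or_pos g with rfl | hg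
  · by_cases hr : 4 ≤ r
    · exact exists_hom_cuspOrder_avoiding_of_four_le hr hp k
    · have hr3 : r = 3 := by unfold IsHyperbolicType at h; omega
      subst hr3
      exact exists_hom_cuspOrder_avoiding_tripod hp k
  · exact exists_hom_cuspOrder_avoiding_of_pos_genus h hg hp k

/-- **All hyperbolic types, kernel form** — the clause consumed on the pro-`Σ` side (surface-type
vertices of a semi-graph of anabelioids, [SemiAnbd] Ex. 2.10 (2)), where a finite quotient of
`Γ_{g,r}` extends along the pro-`Σ` completion as soon as `ker f` has `Σ`-integer index: as
`exists_hom_cuspOrder_avoiding`, recording that `ker f` has `p`-power index.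
[cite: MochizukiSemiAnbd2006, Ex. 2.10 p.31] -/
theorem exists_hom_cuspOrder_avoiding_ker (h : IsHyperbolicType g r) {p : ℕ} (hp : p.Prime) (k : ℕ) :
    ∃ (Q : Type) (_ : Group Q) (_ : Finite Q) (f : PuncturedSurfaceGroup g r →* Q)
      (N : Subgroup Q), (∃ a, f.ker.index ∣ p ^ a) ∧ (∀ j, orderOf (f (c j)) = p ^ (k + 1)) ∧
      N ≤ f.range ∧ p ^ k ≤ Nat.card N ∧
      ∀ (j : Fin r) (q : Q), N ⊓ ConjAct.toConjAct q • Subgroup.zpowers (f (c j)) = ⊥ := by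
  obtain ⟨Q, _, _, f, N, ⟨a, hQ⟩, hord, hNle, hNcard, hNav⟩ := exists_hom_cuspOrder_avoiding h hp k
  exact ⟨Q, inferInstance, inferInstance, f, N, ⟨a, (index_ker_dvd_card f).trans hQ⟩, hord, hNle,
    hNcard, hNav⟩

end Literature.GroupTheory.CombinatorialGroupTheory.PuncturedSurfaceGroup
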